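import Summits.BirchSwinnertonDyer.BirchSwinnertonDyer.Theorems.EisensteinPrimesBSDpOnCellCTelescopeKernel
import Summits.BirchSwinnertonDyer.BirchSwinnertonDyer.Theorems.EisensteinPrimesBSDpOnCellCOfNamedFactsV14
import Summits.BirchSwinnertonDyer.BirchSwinnertonDyer.Theorems.SignedBaseChangeAnticyclotomicEisensteinDivisibilitySpecializationHerbrand
import HarnessLib

/-!
# Line «telescope» — K2 SPLIT PATCH (ideator bsd-idea-12 g29; for the LEAD cruxlead-19034, to adopt or not at a cycle boundary)

THIS FILE IS NOT A SKELETON and is never `skeleton check`ed (W-79): it is a self-contained, farm-checked PATCH against the REGISTERED line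
«telescope» (v1 of record sha256 1d5bbb30…, LEAD's v2 859111e5… in preparation), answering the LEAD's «telescopeCarrier CONTENT (MIXED → split,
v3 draft this gen)» and director-bsd (383)/(387)/(390) «benchable stubs». It proves, SORRY-FREE,

  `stub_telescopeCarrier_of_K2split : TelescopeCarrierStatement` from TWO new stubs, and
  `example : <the registered text of stub_telescopeCarrier, token-identical> := telescopeCarrier_of_witness stub_selmerWitness stub_herbrandTranslate`,

so the LEAD can replace the ONE research stub `stub_telescopeCarrier` (K2+D3) by
  * `stub_selmerWitness`   (K2-W, RESEARCH, size XL): the carrier's data `(F, L, x)` PLUS a finitely generated `R₀⟦X⟧⟦T⟧`-module `𝒩` with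
    `charIdeal 𝒩 = (F)`, per member a regularity element `s_k ∉ (X − x_k)` killing `𝒩`, and the member clause stated at MODULE level as the
    one-sided control (ctrl_k) «`p^j · char(𝔛(g_k)) · 𝓞_{ℂ_p}⟦T⟧ ⊆ char_{R₀⟦T⟧}(𝒩/(X − x_k)𝒩) · 𝓞_{ℂ_p}⟦T⟧`» (the COKERNEL half of control —
    the half that holds without residual irreducibility in the cyclotomic analogue, Ochiai 2006 §5); every other clause of the carrier verbatim;
  * `stub_herbrandTranslate` (K2-H, BENCH, size M, PURE COMMUTATIVE ALGEBRA, true as stated): for Noetherian factorial domains `A → B` with a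
    retraction `φ : B →+* A` whose kernel is `(π)`, and a finite `B`-module `N` killed by some `s ∉ (π)`:
    `charIdeal A (N/πN) ≤ (charIdeal B N).map φ` — the «⊆» half of the Herbrand / Euler-characteristic specialisation identity
    (Delbourgo 2008 Lemma 10.5; Ochiai 2006 Lemma 7.2; the tree's `PowerSeriesSpecialization.charIdeal_quotSMulTop_eq_mul` is the case
    `π = X`, `φ = constantCoeff`);
  glued by the kernel `telescopeCarrier_of_witness` (§K2: coefficientwise evaluation `evInner` of the INNER variable at `x_k ∈ 𝔪`, kernel
  `= (C (X − C x_k))`, factoriality of `R₀⟦T⟧` and `R₀⟦X⟧⟦T⟧` from tree theorems, `Φ_k := F(x_k, T)`).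

SPLICE (mechanical, for the LEAD's v2 → v3): add ONE import (`…Theorems.SignedBaseChangeAnticyclotomicEisensteinDivisibilitySpecializationHerbrand`;
the other three of this file are in the closure of `…MemberDivOfThm308`); delete `stub_telescopeCarrier`; paste §S' + §D + §K2 below the stubs; in `BSDpOnCellC_of` replace the argument `stub_telescopeCarrier` by `(telescopeCarrier_of_witness stub_selmerWitness stub_herbrandTranslate)`
(the `example` at the end of this file certifies that this term elaborates against the raw registered text). Stub count v2 5 → v3 6; RESTUB tokens:
selmerWitness CONTENT (research) · herbrandTranslate CONTENT → «p9 bench: stub_herbrandTranslate (M, pure algebra)».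

HONESTY: BSD is proved for no curve; nothing here proves the crux, a registered stub, or any summit statement — the two new stubs are `sorry`,
and `stub_telescopeCarrier_of_K2split` is conditional on them. `lean check`: sorries ONLY in the two `stub_*`; axioms of
`telescopeCarrier_of_witness` = {propext, Classical.choice, Quot.sound}. Card: `Lines/telescope-K2split.md`.
-/

set_option autoImplicit false
set_option linter.dupNamespace false

noncomputable section

open scoped Classical MatrixGroups ModularForm

open CongruenceSubgroup WeierstrassCurve NumberField IsDedekindDomain Field PowerSeries
  Literature.NumberTheory.EllipticCurves Literature.NumberTheory.EllipticCurves.GreenbergSelmer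
  Literature.NumberTheory.EllipticCurves.ModularForms Literature.NumberTheory.QuadraticFields
  Literature.NumberTheory.EllipticCurves.Rank1Residual
  Literature.NumberTheory.EllipticCurves.Rank1Residual.Typed
  Literature.NumberTheory.EllipticCurves.KrizLi2019
  Literature.NumberTheory.EllipticCurves.GreenbergVatsal2000
  Literature.NumberTheory.EllipticCurves.Wuthrich2014
  Literature.NumberTheory.EllipticCurves.SteinWuthrich2013
  Literature.NumberTheory.EllipticCurves.Castella2018Exceptional
  Literature.NumberTheory.GaloisRepresentations Literature.NumberTheory.GaloisCohomology
  Literature.NumberTheory.Automorphic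
  Summit.BirchSwinnertonDyer.Rank1Residual.X11b.AcSelmer
  Summit.BirchSwinnertonDyer.Rank1Residual.X11b.Halves
  Summit.BirchSwinnertonDyer.Rank1Residual.X11b
  Summit.BirchSwinnertonDyer.Rank1Residual Summit.BirchSwinnertonDyer.Rank1Residual.X1
  Summit.BirchSwinnertonDyer.Rank1Residual.X2
open Literature.NumberTheory.EllipticCurves.KellerYin2024 (curveLocalLambda)


open Literature.NumberTheory.EllipticCurves.BigGaloisRep

namespace Summit.BirchSwinnertonDyer.BirchSwinnertonDyer.Cruxes.BSDpOnCellC.Telescope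

open Literature.NumberTheory.EllipticCurves.CastellaGrossiLeeSkinner2022 Literature.NumberTheory.EllipticCurves.Castella2018
  Literature.NumberTheory.IwasawaTheory Literature.NumberTheory.IwasawaTheory.Greenberg2016
  Literature.NumberTheory.IwasawaTheory.Greenberg2006
  Summit.BirchSwinnertonDyer.Rank1Residual.X1.KellerYinMuLambdaSplit
open Literature.NumberTheory.EllipticCurves.KellerYin2024
open Summit.BirchSwinnertonDyer.BirchSwinnertonDyer.Theorems

/-! ## §S' The two new stubs (K2-W research, K2-H bench) -/

/-- **stub_selmerWitness** [K2-W of crux idea «telescope» (v2 re-cut of v1's `stub_telescopeCarrier`), NEW OBJECT, research-grade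
(XL): the SELMER WITNESS of the carrier]. Under the binders of road R-β there exist `F, L ∈ R₀⟦X⟧⟦T⟧` (`R₀ = unrIntegers p`; `X` = the
weight variable centred at weight 2 — the INNER variable; `T` = the anticyclotomic variable — the OUTER one), weights `x_k → 0` in `pℤ_p`,
AND a finitely generated `R₀⟦X⟧⟦T⟧`-module `𝒩` (an `R₀⟦T⟧`-module through `PowerSeries.C`, `IsScalarTower`) with
`char_{R₀⟦X⟧⟦T⟧}(𝒩) = (F)` — morally the Pontryagin dual of the BDP-type (`𝔭bar`-slot, `Σ = ∅`) Selmer group of the self-dual big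
Galois representation over the Eisenstein Hida branch through `f_E`, base-changed to `R₀` — such that: (nondeg) `X ∤ F`; (alg∞), (an∞)
VERBATIM the carrier's limit clauses (control «⊆» and BDP interpolation at the weight-2 point, element form); and for every `k` a congruent
member `g_k` (`Skinner2016.HidaCongruentForm W p 1`) at weight `x_k` with its BDP frame, an analytic fibre `Ψ_k ≡ L (mod X - x_k)` with
(an_k) `p^e Ψ_k ∈ (L^{BDP}(g_k))`, a REGULARITY element `s_k ∉ (X - x_k)` killing `𝒩` (`𝒩` is torsion and the divisor `X = x_k` avoids
its support), and (ctrl_k) MODULE-LEVEL CONTROL «⊆» at the member: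
`p^j · char_{Λ_𝒪}(𝔛_{𝔭bar}(g_k)) · 𝓞_{ℂ_p}⟦T⟧ ⊆ char_{R₀⟦T⟧}(𝒩/(X - x_k)𝒩) · 𝓞_{ℂ_p}⟦T⟧` — the member fibre of `𝒩` carries AT MOST
the torsion of the member's Selmer dual up to `p^j`, i.e. dually «`coker(res_k : Sel(g_k) → Sel_big[X - x_k])` is `p`-power × pseudo-null»,
the COKERNEL half of the control theorem (the half that holds WITHOUT residual irreducibility in the cyclotomic analogue: Ochiai, Compos.
Math. 142 (2006) §5, Prop. 5.1 and the paragraph before §5.1; weight-variable control at weight 2 for the vertical deformation of `Ta_p E`: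
Delbourgo, *Elliptic Curves and Big Galois Representations* (2008) Thm. 7.15 and App. C (P. Smith) Thm. C.15; BDP-type Selmer groups over
Hida families: Castella–Wan arXiv:1607.02019 §§3–4; Howard, Invent. Math. 167 (2007) Thm. 3). v1's element-level member clause (alg_k)
`p^j char(𝔛(g_k)) ⊆ (Φ_k)`, `Φ_k ≡ F (mod X - x_k)` is RECOVERED from (ctrl_k) + `stub_herbrandTranslate` by the sorry-free kernel
`telescopeCarrier_of_witness` (§K2) with `Φ_k := F(x_k, T)`; the carrier statement itself is now DERIVED, not stubbed.
Why it might fail: at Eisenstein `p ‖ N` (`ρ̄` reducible, `f_E` `p`-new with `U_p`-eigenvalue `±1`) torsionness of `𝒩` with PRINCIPAL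
characteristic ideal over the non-Gorenstein branch and coker-control up to `p`-power × pseudo-null at EVERY member are printed only for
FREE big Galois representations under (irr)/(dist); a non-free family lattice, or an error term whose `T`-support grows with `k`, breaks
(ctrl_k)/(alg∞). Not a claim that this stub is proved. -/
theorem stub_selmerWitness :
    ∀ (W : WeierstrassCurve ℚ) [W.IsElliptic] [W.IsGloballyMinimal] (p : ℕ) [Fact p.Prime],
    ∀ (N : ℕ) [NeZero N] (K : Type) [Field K] [NumberField K] (Dt : ModularParametrizationData W N)
      (H : HeegnerDatum N (NumberField.discr K)) (ιK : K →+* ℂ) (P : (W.baseChange K).toAffine.Point),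
      CellC W p → W.conductorNorm ℤ = N →
      IsImaginaryQuadratic K → NumberField.discr K < -4 → SatisfiesHeegnerHypothesis N K →
      (W.quadraticTwist (NumberField.discr K : ℚ)).entireLFunction 1 ≠ 0 →
      WeierstrassCurve.Affine.Point.map ιK.toRatAlgHom P = heegnerPointComplex Dt H →
      ¬ (p : ℤ) ∣ Dt.c → ¬ IsOfFinAddOrder P →
      Odd (NumberField.discr K) →
      ∀ (κ : ZpExtension K p), κ.IsAnticyclotomic →
        ∀ (γ : Field.absoluteGaloisGroup K) [Fact (κ.IsTopGenerator γ)]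
          (𝔭 : HeightOneSpectrum (𝓞 K)), ((p : ℕ) : 𝓞 K) ∈ 𝔭.asIdeal →
          𝔭.asIdeal.ramificationIdx (𝓞 ℚ) = 1 → 𝔭.asIdeal.inertiaDeg (𝓞 ℚ) = 1 →
          ∀ (𝔭bar : HeightOneSpectrum (𝓞 K)), ((p : ℕ) : 𝓞 K) ∈ 𝔭bar.asIdeal → 𝔭bar ≠ 𝔭 →
            ((Ideal.span {(p : ℤ)}).primesOver (𝓞 K)).ncard = 2 →
          ∀ (f : CuspForm (CongruenceSubgroup.Gamma0 N) 2), IsNewformOf W f →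
            ∀ (ι' : PadicAlgCl p ≃+* ℂ),
              (∀ (w : InfinitePlace K) (k : 𝓞 K),
                k ∈ 𝔭.asIdeal ↔ ‖ι'.symm (w.embedding (k : K))‖ < 1) →
              ∀ (ΩK : ℂ) (Ωp : ℂ_[p]) (Q : PowerSeries 𝓞_ℂ_[p]), ΩK ≠ 0 → ‖Ωp‖ = 1 →
                R1.IsBDPLFunctionInt p ι' 𝔭 κ γ f ΩK Ωp Q →
      ∃ (F L : PowerSeries (PowerSeries (unrIntegers p))) (x : ℕ → ℤ_[p])
        (𝒩 : Type) (_ : AddCommGroup 𝒩) (_ : Module (PowerSeries (PowerSeries (unrIntegers p))) 𝒩)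
        (_ : Module (PowerSeries (unrIntegers p)) 𝒩)
        (_ : IsScalarTower (PowerSeries (unrIntegers p)) (PowerSeries (PowerSeries (unrIntegers p))) 𝒩)
        (_ : Module.Finite (PowerSeries (PowerSeries (unrIntegers p))) 𝒩),
        Literature.NumberTheory.EllipticCurves.Module.charIdeal (PowerSeries (PowerSeries (unrIntegers p))) 𝒩 =
          Ideal.span {F} ∧
        (∀ k, ‖x k‖ < 1) ∧ Filter.Tendsto x Filter.atTop (nhds 0) ∧
        ¬ (PowerSeries.C (PowerSeries.X : PowerSeries (unrIntegers p)) ∣ F) ∧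
        (∃ j : ℕ, PowerSeries.C ((p : 𝓞_ℂ_[p]) ^ j) *
            PowerSeries.map (R1.unrToCpInt p) (PowerSeries.map (PowerSeries.constantCoeff (R := unrIntegers p)) F) ∈
          (XAc.charIdeal (W.baseChange K) p κ 𝔭bar ∅ γ).map (PowerSeries.map (R1.toCpInt p))) ∧
        (∃ e : ℕ, PowerSeries.C ((p : 𝓞_ℂ_[p]) ^ e) * Q ∈
          Ideal.span {PowerSeries.map (R1.unrToCpInt p) (PowerSeries.map (PowerSeries.constantCoeff (R := unrIntegers p)) L)}) ∧
        ∀ k : ℕ, ∃ (D : Skinner2016.HidaCongruentForm W p 1),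
          (∀ y : coeffField D.g, ι' (D.ι y) = (y : ℂ)) ∧ 2 * ((p : ℤ) - 1) ∣ D.k - 2 ∧
          ∃ (ΩKg : ℂ) (Ωpg : ℂ_[p]) (Lg : UnrSeries p), ΩKg ≠ 0 ∧ ‖Ωpg‖ = 1 ∧
            IsBDPLFunctionWt ι' 𝔭 κ γ D.g ΩKg Ωpg Lg ∧
          ∃ (Ψ : UnrSeries p),
            (∃ U : PowerSeries (PowerSeries (unrIntegers p)),
              PowerSeries.map (PowerSeries.C (R := unrIntegers p)) Ψ =
                L + PowerSeries.C (PowerSeries.X - PowerSeries.C (toUnr p (x k))) * U) ∧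
            (∃ e : ℕ, PowerSeries.C ((p : 𝓞_ℂ_[p]) ^ e) * PowerSeries.map (R1.unrToCpInt p) Ψ ∈
              Ideal.span {PowerSeries.map (R1.unrToCpInt p) Lg}) ∧
            (∃ s : PowerSeries (PowerSeries (unrIntegers p)),
              ¬ (PowerSeries.C (PowerSeries.X - PowerSeries.C (toUnr p (x k))) ∣ s) ∧ ∀ m : 𝒩, s • m = 0) ∧
            ∀ (b : padicCoeffIntegers D.ι →+* 𝓞_ℂ_[p]),
              (∀ y, ((b y : 𝓞_ℂ_[p]) : ℂ_[p]) =
                algebraMap (PadicAlgCl p) ℂ_[p] (padicCoeffIntegers.toPadicAlgCl D.ι y)) →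
            ∀ [TopologicalSpace (PowerSeries (padicCoeffIntegers D.ι))]
              [ContinuousSMul (PowerSeries (padicCoeffIntegers D.ι))
                (BigRepModule (padicCoeffIntegers D.ι) p (Cofree D.Δ.selfDualRep (padicCoeffField D.ι)))],
              ∃ j : ℕ, Ideal.span {PowerSeries.C ((p : 𝓞_ℂ_[p]) ^ j)} *
                  (XBig.charIdeal κ (D.Δ.selfDualCofreeRepOver K) 𝔭bar
                    (∅ : Set (HeightOneSpectrum (𝓞 K)))).map (PowerSeries.map b) ≤
                (Literature.NumberTheory.EllipticCurves.Module.charIdeal (PowerSeries (unrIntegers p))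
                    (QuotSMulTop (PowerSeries.C (PowerSeries.X - PowerSeries.C (toUnr p (x k)))) 𝒩)).map
                  (PowerSeries.map (R1.unrToCpInt p))
    := by
  sorry

/-- **stub_herbrandTranslate** [K2-H of crux idea «telescope» (v2), PURE COMMUTATIVE ALGEBRA, bench-grade (M)]: ONE-SIDED HERBRAND /
EULER-CHARACTERISTIC SPECIALISATION of characteristic ideals along a RETRACTION. Data: Noetherian factorial domains `A → B` (`Algebra A B`)
with a ring retraction `φ : B →+* A` (`φ ∘ algebraMap = id`) whose kernel is `(π)` (`φ π = 0`, `φ b = 0 → π ∣ b`); a finite `B`-module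
`N` (an `A`-module by `IsScalarTower`) killed by some `s ∉ (π)`. Conclusion: `char_A(N/πN) ⊆ φ(char_B N)·A` (`charIdeal` = the tree's
generic `Literature.NumberTheory.EllipticCurves.Module.charIdeal`; `N/πN = QuotSMulTop π N`). Instance used in §K2: `A = R₀⟦T⟧`,
`B = R₀⟦X⟧⟦T⟧`, `π = X - x_k` (a constant in the inner variable), `φ = evInner` (coefficientwise evaluation `X ↦ x_k`).
Proof sketch (standard): `s ∈ Ann N`, `π ∤ s` ⇒ `N` is `B`-torsion with no height-one support at `(π)`, so `f := gen(char_B N)` has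
`φ f ≠ 0`, and `N/πN` is a finite torsion `A`-module (killed by `φ s ≠ 0`); localise at a height-one prime `𝔮 ⊂ A`, `Q := φ⁻¹𝔮` (height
2; `B_Q` is regular local of dimension 2 since `B_Q/π = A_𝔮` is a DVR); the Euler characteristic `e(M) := ℓ_{A_𝔮}(M/πM) − ℓ_{A_𝔮}(M[π])`
is additive in short exact sequences of finite torsion `B_Q`-modules killed by an element prime to `π` (snake lemma), vanishes on modules
of finite length, and equals `ord_𝔮(φ g)` on `B_Q/(g)` (`π ∤ g` ⇒ `M[π] = 0`); a prime filtration of `N_Q` gives `e(N_Q) = ord_𝔮(φ f)`,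
whence `ℓ_𝔮(N/πN) ≥ ord_𝔮(φ f)` for every `𝔮`, i.e. the claim (`A` factorial: `(φ f) = ∏ 𝔮^{ord_𝔮(φ f)}`). The OPPOSITE inclusion is
false in general (pseudo-null `B`-modules such as `B/(p, π)` contribute `(p)` to the fibre and `(1)` to `φ(char_B)`), which is why the
witness states member control one-sidedly. Generalises the tree's `PowerSeriesSpecialization.charIdeal_quotSMulTop_eq_mul` and
`PrintCf2.LinePushOneSided.charIdeal_quotSMulTop_le_map_constantCoeff` (the case `B = A⟦X⟧`, `π = X`, `φ = constantCoeff`; two-sided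
engine `Literature…IwasawaAlgebra.charIdeal_eq_mul_of_exact`). Sources: Delbourgo, *Elliptic Curves and Big Galois Representations*
(2008) Lemma 10.5 (leading-term formula `𝔆_M(Y)|_{Y=0} = char_R(coker α)/char_R(ker α)`, `α : M[Y] → M/YM` — its torsion case is the
two-sided Herbrand identity of which this stub is the «⊆» half); Ochiai, Compos. Math. 142 (2006) Lemma 7.2 (specialisation of
characteristic ideals modulo height-one primes, the pseudo-null obstruction `(Sel^∨)_null/J`); Skinner–Urban 2014 Cor. 3.2.9 (as cited by
the tree's `charIdeal_quotSMulTop_eq_mul`); Bourbaki AC VII §4.4–4.5.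
Why it might fail: only by mis-typing — the junk values of the generic `charIdeal` (`⊤` on non-torsion modules, `ENat.toNat ⊤ = 0`) are
excluded on BOTH sides by the `s`-hypothesis; the degenerate case `π = 0` (`φ` an isomorphism) holds by transport of structure. -/
theorem stub_herbrandTranslate :
    ∀ (A B : Type) [CommRing A] [CommRing B] [IsDomain A] [IsDomain B] [IsNoetherianRing A] [IsNoetherianRing B]
      [UniqueFactorizationMonoid A] [UniqueFactorizationMonoid B] [Algebra A B]
      (π : B) (φ : B →+* A),
      (∀ a : A, φ (algebraMap A B a) = a) → φ π = 0 → (∀ b : B, φ b = 0 → π ∣ b) →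
    ∀ (N : Type) [AddCommGroup N] [Module B N] [Module A N] [IsScalarTower A B N] [Module.Finite B N],
      (∃ s : B, ¬ π ∣ s ∧ ∀ m : N, s • m = 0) →
      Literature.NumberTheory.EllipticCurves.Module.charIdeal A (QuotSMulTop π N) ≤
        (Literature.NumberTheory.EllipticCurves.Module.charIdeal B N).map φ
    := by
  sorry


/-! ## §D The registered carrier statement as a named `Prop` (token-identical to `stub_telescopeCarrier` of record) -/

/-- The weight×anticyclotomic CARRIER (K2+D3 of v1, there the statement of `stub_telescopeCarrier`): in v2 it is no longer a stub but
is DERIVED from `stub_selmerWitness` + `stub_herbrandTranslate` by `telescopeCarrier_of_witness` (§K2). -/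
def TelescopeCarrierStatement : Prop :=
    ∀ (W : WeierstrassCurve ℚ) [W.IsElliptic] [W.IsGloballyMinimal] (p : ℕ) [Fact p.Prime],
    ∀ (N : ℕ) [NeZero N] (K : Type) [Field K] [NumberField K] (Dt : ModularParametrizationData W N)
      (H : HeegnerDatum N (NumberField.discr K)) (ιK : K →+* ℂ) (P : (W.baseChange K).toAffine.Point),
      CellC W p → W.conductorNorm ℤ = N →
      IsImaginaryQuadratic K → NumberField.discr K < -4 → SatisfiesHeegnerHypothesis N K →
      (W.quadraticTwist (NumberField.discr K : ℚ)).entireLFunction 1 ≠ 0 →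
      WeierstrassCurve.Affine.Point.map ιK.toRatAlgHom P = heegnerPointComplex Dt H →
      ¬ (p : ℤ) ∣ Dt.c → ¬ IsOfFinAddOrder P →
      Odd (NumberField.discr K) →
      ∀ (κ : ZpExtension K p), κ.IsAnticyclotomic →
        ∀ (γ : Field.absoluteGaloisGroup K) [Fact (κ.IsTopGenerator γ)]
          (𝔭 : HeightOneSpectrum (𝓞 K)), ((p : ℕ) : 𝓞 K) ∈ 𝔭.asIdeal →
          𝔭.asIdeal.ramificationIdx (𝓞 ℚ) = 1 → 𝔭.asIdeal.inertiaDeg (𝓞 ℚ) = 1 →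
          ∀ (𝔭bar : HeightOneSpectrum (𝓞 K)), ((p : ℕ) : 𝓞 K) ∈ 𝔭bar.asIdeal → 𝔭bar ≠ 𝔭 →
            ((Ideal.span {(p : ℤ)}).primesOver (𝓞 K)).ncard = 2 →
          ∀ (f : CuspForm (CongruenceSubgroup.Gamma0 N) 2), IsNewformOf W f →
            ∀ (ι' : PadicAlgCl p ≃+* ℂ),
              (∀ (w : InfinitePlace K) (k : 𝓞 K),
                k ∈ 𝔭.asIdeal ↔ ‖ι'.symm (w.embedding (k : K))‖ < 1) →
              ∀ (ΩK : ℂ) (Ωp : ℂ_[p]) (Q : PowerSeries 𝓞_ℂ_[p]), ΩK ≠ 0 → ‖Ωp‖ = 1 →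
                R1.IsBDPLFunctionInt p ι' 𝔭 κ γ f ΩK Ωp Q →
      ∃ (F L : PowerSeries (PowerSeries (unrIntegers p))) (x : ℕ → ℤ_[p]),
        (∀ k, ‖x k‖ < 1) ∧ Filter.Tendsto x Filter.atTop (nhds 0) ∧
        ¬ (PowerSeries.C (PowerSeries.X : PowerSeries (unrIntegers p)) ∣ F) ∧
        (∃ j : ℕ, PowerSeries.C ((p : 𝓞_ℂ_[p]) ^ j) *
            PowerSeries.map (R1.unrToCpInt p) (PowerSeries.map (PowerSeries.constantCoeff (R := unrIntegers p)) F) ∈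
          (XAc.charIdeal (W.baseChange K) p κ 𝔭bar ∅ γ).map (PowerSeries.map (R1.toCpInt p))) ∧
        (∃ e : ℕ, PowerSeries.C ((p : 𝓞_ℂ_[p]) ^ e) * Q ∈
          Ideal.span {PowerSeries.map (R1.unrToCpInt p) (PowerSeries.map (PowerSeries.constantCoeff (R := unrIntegers p)) L)}) ∧
        ∀ k : ℕ, ∃ (D : Skinner2016.HidaCongruentForm W p 1),
          (∀ y : coeffField D.g, ι' (D.ι y) = (y : ℂ)) ∧ 2 * ((p : ℤ) - 1) ∣ D.k - 2 ∧
          ∃ (ΩKg : ℂ) (Ωpg : ℂ_[p]) (Lg : UnrSeries p), ΩKg ≠ 0 ∧ ‖Ωpg‖ = 1 ∧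
            IsBDPLFunctionWt ι' 𝔭 κ γ D.g ΩKg Ωpg Lg ∧
          ∃ (Φ Ψ : UnrSeries p),
            (∃ G U : PowerSeries (PowerSeries (unrIntegers p)),
              PowerSeries.map (PowerSeries.C (R := unrIntegers p)) Φ =
                F * G + PowerSeries.C (PowerSeries.X - PowerSeries.C (toUnr p (x k))) * U) ∧
            (∃ U : PowerSeries (PowerSeries (unrIntegers p)),
              PowerSeries.map (PowerSeries.C (R := unrIntegers p)) Ψ =
                L + PowerSeries.C (PowerSeries.X - PowerSeries.C (toUnr p (x k))) * U) ∧
            (∃ e : ℕ, PowerSeries.C ((p : 𝓞_ℂ_[p]) ^ e) * PowerSeries.map (R1.unrToCpInt p) Ψ ∈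
              Ideal.span {PowerSeries.map (R1.unrToCpInt p) Lg}) ∧
            ∀ (b : padicCoeffIntegers D.ι →+* 𝓞_ℂ_[p]),
              (∀ y, ((b y : 𝓞_ℂ_[p]) : ℂ_[p]) =
                algebraMap (PadicAlgCl p) ℂ_[p] (padicCoeffIntegers.toPadicAlgCl D.ι y)) →
            ∀ [TopologicalSpace (PowerSeries (padicCoeffIntegers D.ι))]
              [ContinuousSMul (PowerSeries (padicCoeffIntegers D.ι))
                (BigRepModule (padicCoeffIntegers D.ι) p (Cofree D.Δ.selfDualRep (padicCoeffField D.ι)))],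
              ∃ j : ℕ, Ideal.span {PowerSeries.C ((p : 𝓞_ℂ_[p]) ^ j)} *
                  (XBig.charIdeal κ (D.Δ.selfDualCofreeRepOver K) 𝔭bar
                    (∅ : Set (HeightOneSpectrum (𝓞 K)))).map (PowerSeries.map b) ≤
                Ideal.span {PowerSeries.map (R1.unrToCpInt p) Φ}


/-! ## §K2 The witness kernel (v2, sorry-free): carrier from the Selmer witness and the Herbrand brick -/

/-- The statement of `stub_herbrandTranslate` as a named `Prop` (K2-H). -/
def HerbrandTranslateStatement : Prop :=
    ∀ (A B : Type) [CommRing A] [CommRing B] [IsDomain A] [IsDomain B] [IsNoetherianRing A] [IsNoetherianRing B]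
      [UniqueFactorizationMonoid A] [UniqueFactorizationMonoid B] [Algebra A B]
      (π : B) (φ : B →+* A),
      (∀ a : A, φ (algebraMap A B a) = a) → φ π = 0 → (∀ b : B, φ b = 0 → π ∣ b) →
    ∀ (N : Type) [AddCommGroup N] [Module B N] [Module A N] [IsScalarTower A B N] [Module.Finite B N],
      (∃ s : B, ¬ π ∣ s ∧ ∀ m : N, s • m = 0) →
      Literature.NumberTheory.EllipticCurves.Module.charIdeal A (QuotSMulTop π N) ≤
        (Literature.NumberTheory.EllipticCurves.Module.charIdeal B N).map φ

/-- The statement of `stub_selmerWitness` as a named `Prop` (K2-W). -/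
def SelmerWitnessStatement : Prop :=
    ∀ (W : WeierstrassCurve ℚ) [W.IsElliptic] [W.IsGloballyMinimal] (p : ℕ) [Fact p.Prime],
    ∀ (N : ℕ) [NeZero N] (K : Type) [Field K] [NumberField K] (Dt : ModularParametrizationData W N)
      (H : HeegnerDatum N (NumberField.discr K)) (ιK : K →+* ℂ) (P : (W.baseChange K).toAffine.Point),
      CellC W p → W.conductorNorm ℤ = N →
      IsImaginaryQuadratic K → NumberField.discr K < -4 → SatisfiesHeegnerHypothesis N K →
      (W.quadraticTwist (NumberField.discr K : ℚ)).entireLFunction 1 ≠ 0 →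
      WeierstrassCurve.Affine.Point.map ιK.toRatAlgHom P = heegnerPointComplex Dt H →
      ¬ (p : ℤ) ∣ Dt.c → ¬ IsOfFinAddOrder P →
      Odd (NumberField.discr K) →
      ∀ (κ : ZpExtension K p), κ.IsAnticyclotomic →
        ∀ (γ : Field.absoluteGaloisGroup K) [Fact (κ.IsTopGenerator γ)]
          (𝔭 : HeightOneSpectrum (𝓞 K)), ((p : ℕ) : 𝓞 K) ∈ 𝔭.asIdeal →
          𝔭.asIdeal.ramificationIdx (𝓞 ℚ) = 1 → 𝔭.asIdeal.inertiaDeg (𝓞 ℚ) = 1 →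
          ∀ (𝔭bar : HeightOneSpectrum (𝓞 K)), ((p : ℕ) : 𝓞 K) ∈ 𝔭bar.asIdeal → 𝔭bar ≠ 𝔭 →
            ((Ideal.span {(p : ℤ)}).primesOver (𝓞 K)).ncard = 2 →
          ∀ (f : CuspForm (CongruenceSubgroup.Gamma0 N) 2), IsNewformOf W f →
            ∀ (ι' : PadicAlgCl p ≃+* ℂ),
              (∀ (w : InfinitePlace K) (k : 𝓞 K),
                k ∈ 𝔭.asIdeal ↔ ‖ι'.symm (w.embedding (k : K))‖ < 1) →
              ∀ (ΩK : ℂ) (Ωp : ℂ_[p]) (Q : PowerSeries 𝓞_ℂ_[p]), ΩK ≠ 0 → ‖Ωp‖ = 1 →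
                R1.IsBDPLFunctionInt p ι' 𝔭 κ γ f ΩK Ωp Q →
      ∃ (F L : PowerSeries (PowerSeries (unrIntegers p))) (x : ℕ → ℤ_[p])
        (𝒩 : Type) (_ : AddCommGroup 𝒩) (_ : Module (PowerSeries (PowerSeries (unrIntegers p))) 𝒩)
        (_ : Module (PowerSeries (unrIntegers p)) 𝒩)
        (_ : IsScalarTower (PowerSeries (unrIntegers p)) (PowerSeries (PowerSeries (unrIntegers p))) 𝒩)
        (_ : Module.Finite (PowerSeries (PowerSeries (unrIntegers p))) 𝒩),
        Literature.NumberTheory.EllipticCurves.Module.charIdeal (PowerSeries (PowerSeries (unrIntegers p))) 𝒩 =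
          Ideal.span {F} ∧
        (∀ k, ‖x k‖ < 1) ∧ Filter.Tendsto x Filter.atTop (nhds 0) ∧
        ¬ (PowerSeries.C (PowerSeries.X : PowerSeries (unrIntegers p)) ∣ F) ∧
        (∃ j : ℕ, PowerSeries.C ((p : 𝓞_ℂ_[p]) ^ j) *
            PowerSeries.map (R1.unrToCpInt p) (PowerSeries.map (PowerSeries.constantCoeff (R := unrIntegers p)) F) ∈
          (XAc.charIdeal (W.baseChange K) p κ 𝔭bar ∅ γ).map (PowerSeries.map (R1.toCpInt p))) ∧
        (∃ e : ℕ, PowerSeries.C ((p : 𝓞_ℂ_[p]) ^ e) * Q ∈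
          Ideal.span {PowerSeries.map (R1.unrToCpInt p) (PowerSeries.map (PowerSeries.constantCoeff (R := unrIntegers p)) L)}) ∧
        ∀ k : ℕ, ∃ (D : Skinner2016.HidaCongruentForm W p 1),
          (∀ y : coeffField D.g, ι' (D.ι y) = (y : ℂ)) ∧ 2 * ((p : ℤ) - 1) ∣ D.k - 2 ∧
          ∃ (ΩKg : ℂ) (Ωpg : ℂ_[p]) (Lg : UnrSeries p), ΩKg ≠ 0 ∧ ‖Ωpg‖ = 1 ∧
            IsBDPLFunctionWt ι' 𝔭 κ γ D.g ΩKg Ωpg Lg ∧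
          ∃ (Ψ : UnrSeries p),
            (∃ U : PowerSeries (PowerSeries (unrIntegers p)),
              PowerSeries.map (PowerSeries.C (R := unrIntegers p)) Ψ =
                L + PowerSeries.C (PowerSeries.X - PowerSeries.C (toUnr p (x k))) * U) ∧
            (∃ e : ℕ, PowerSeries.C ((p : 𝓞_ℂ_[p]) ^ e) * PowerSeries.map (R1.unrToCpInt p) Ψ ∈
              Ideal.span {PowerSeries.map (R1.unrToCpInt p) Lg}) ∧
            (∃ s : PowerSeries (PowerSeries (unrIntegers p)),
              ¬ (PowerSeries.C (PowerSeries.X - PowerSeries.C (toUnr p (x k))) ∣ s) ∧ ∀ m : 𝒩, s • m = 0) ∧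
            ∀ (b : padicCoeffIntegers D.ι →+* 𝓞_ℂ_[p]),
              (∀ y, ((b y : 𝓞_ℂ_[p]) : ℂ_[p]) =
                algebraMap (PadicAlgCl p) ℂ_[p] (padicCoeffIntegers.toPadicAlgCl D.ι y)) →
            ∀ [TopologicalSpace (PowerSeries (padicCoeffIntegers D.ι))]
              [ContinuousSMul (PowerSeries (padicCoeffIntegers D.ι))
                (BigRepModule (padicCoeffIntegers D.ι) p (Cofree D.Δ.selfDualRep (padicCoeffField D.ι)))],
              ∃ j : ℕ, Ideal.span {PowerSeries.C ((p : 𝓞_ℂ_[p]) ^ j)} *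
                  (XBig.charIdeal κ (D.Δ.selfDualCofreeRepOver K) 𝔭bar
                    (∅ : Set (HeightOneSpectrum (𝓞 K)))).map (PowerSeries.map b) ≤
                (Literature.NumberTheory.EllipticCurves.Module.charIdeal (PowerSeries (unrIntegers p))
                    (QuotSMulTop (PowerSeries.C (PowerSeries.X - PowerSeries.C (toUnr p (x k)))) 𝒩)).map
                  (PowerSeries.map (R1.unrToCpInt p))

/-! ### Evaluating the inner (weight) variable at a point of the maximal ideal -/

section EvalInner

variable {𝒪 : Type*} [CommRing 𝒪] [IsLocalRing 𝒪] [IsAdicComplete (IsLocalRing.maximalIdeal 𝒪) 𝒪]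

/-- coefficientwise evaluation of the INNER variable `X` at `a ∈ 𝔪`: `𝒪⟦X⟧⟦T⟧ →+* 𝒪⟦T⟧`. -/
def evInner (a : 𝒪) (ha : a ∈ IsLocalRing.maximalIdeal 𝒪) :
    PowerSeries (PowerSeries 𝒪) →+* PowerSeries 𝒪 :=
  PowerSeries.map (AccumHelpers.evAt a ha).toRingHom


lemma evInner_map_C (a : 𝒪) (ha : a ∈ IsLocalRing.maximalIdeal 𝒪) (g : PowerSeries 𝒪) :
    evInner a ha (PowerSeries.map (PowerSeries.C (R := 𝒪)) g) = g := by
  ext n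
  simp only [evInner, PowerSeries.coeff_map, RingHom.coe_coe, AlgHom.toRingHom_eq_coe]
  exact AccumHelpers.evAt_C a ha _

lemma evInner_C (a : 𝒪) (ha : a ∈ IsLocalRing.maximalIdeal 𝒪) (g : PowerSeries 𝒪) :
    evInner a ha (PowerSeries.C g) = PowerSeries.C (AccumHelpers.evAt a ha g) := by
  simp only [evInner, PowerSeries.map_C]
  rfl

lemma evInner_pi (a : 𝒪) (ha : a ∈ IsLocalRing.maximalIdeal 𝒪) :
    evInner a ha (PowerSeries.C (PowerSeries.X - PowerSeries.C a)) = 0 := by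
  rw [evInner_C, map_sub, AccumHelpers.evAt_X, AccumHelpers.evAt_C, sub_self, map_zero]

lemma C_dvd_of_evInner_eq_zero (a : 𝒪) (ha : a ∈ IsLocalRing.maximalIdeal 𝒪)
    (G : PowerSeries (PowerSeries 𝒪)) (h : evInner a ha G = 0) :
    PowerSeries.C (PowerSeries.X - PowerSeries.C a) ∣ G := by
  have hc : ∀ i, (PowerSeries.X - PowerSeries.C a) ∣ PowerSeries.coeff i G := by
    intro i
    rw [← AccumHelpers.evAt_eq_zero_iff a ha]
    have := congrArg (PowerSeries.coeff i) h
    rw [evInner, PowerSeries.coeff_map, map_zero] at this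
    exact this
  choose q hq using hc
  refine ⟨PowerSeries.mk q, PowerSeries.ext fun i => ?_⟩
  rw [PowerSeries.coeff_C_mul, PowerSeries.coeff_mk]
  exact hq i

end EvalInner

/-- `R₀⟦T⟧` is factorial (regular local of dimension 2: Auslander–Buchsbaum), from tree theorems. -/
theorem uniqueFactorizationMonoid_unrSeries (p : ℕ) [Fact p.Prime] :
    UniqueFactorizationMonoid (PowerSeries (unrIntegers p)) := by
  haveI := HidaLimitAlgebra.isDiscreteValuationRing_unrIntegers (p := p)
  haveI := Literature.NumberTheory.GaloisRepresentations.NearlyOrdinaryPresentationCA.isRegularLocalRing_mvPowerSeries_dvr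
    (unrIntegers p) 1
  exact Literature.AlgebraicGeometry.Resolution.uniqueFactorizationMonoid_of_isRegularLocalRing _
    (IsRegularLocalRing.of_ringEquiv (MvPowerSeries.renameEquiv (unrIntegers p) finOneEquiv.symm).toRingEquiv.symm)

set_option maxHeartbeats 1600000 in
/-- **KERNEL K2 (v2).** The carrier from the Selmer witness (K2-W) and the Herbrand brick (K2-H): per member `k`, apply K2-H to the
retraction `φ_k = evInner (x_k) : R₀⟦X⟧⟦T⟧ → R₀⟦T⟧` (kernel `(X - x_k)`, by `C_dvd_of_evInner_eq_zero`) and the fibre `𝒩/(X - x_k)𝒩`;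
with `char 𝒩 = (F)` this gives `char_{R₀⟦T⟧}(fibre) ⊆ (F(x_k,T))`, which chained under (ctrl_k) and pushed to `𝓞_{ℂ_p}⟦T⟧` is v1's
(alg_k) with `Φ_k := F(x_k, T)`; the remainder `Φ_k ≡ F (mod X - x_k)` is the kernel property again (`G := 1`). -/
theorem telescopeCarrier_of_witness (hWit : SelmerWitnessStatement) (hHer : HerbrandTranslateStatement) :
    TelescopeCarrierStatement := by
  intro W _ _ p _ N _ K _ _ Dt H ιK P hC hN hK hdisc hHeeg hL1 hP hc hfin hodd κ hκ γ _ 𝔭 h𝔭 hram hdeg 𝔭bar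
    h𝔭bar hne hsp f hf ι' hι' ΩK Ωp Q hΩK hΩp hQ
  obtain ⟨F, L, x, 𝒩, _i1, _i2, _i3, _i4, _i5, hchar, hxk, hconv, hF, halg, han, hmem⟩ :=
    hWit W p N K Dt H ιK P hC hN hK hdisc hHeeg hL1 hP hc hfin hodd κ hκ γ 𝔭 h𝔭 hram hdeg 𝔭bar h𝔭bar hne
      hsp f hf ι' hι' ΩK Ωp Q hΩK hΩp hQ
  -- the receptacle `R₀ = unrIntegers p`: a complete DVR with uniformiser `p`; `R₀⟦T⟧`, `R₀⟦X⟧⟦T⟧` factorial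
  haveI := HidaLimitAlgebra.isDiscreteValuationRing_unrIntegers (p := p)
  haveI : IsAdicComplete (IsLocalRing.maximalIdeal (unrIntegers p)) (unrIntegers p) :=
    CongruentShaFreeCutUnrSeriesWeierstrass.isAdicComplete_maximalIdeal
  haveI : UniqueFactorizationMonoid (PowerSeries (PowerSeries (unrIntegers p))) :=
    Literature.NumberTheory.IwasawaTheory.uniqueFactorizationMonoid_powerSeries_powerSeries (unrIntegers p)
  haveI : UniqueFactorizationMonoid (PowerSeries (unrIntegers p)) := uniqueFactorizationMonoid_unrSeries p
  have hirr : Irreducible ((p : ℕ) : unrIntegers p) := HidaLimitAlgebra.irreducible_natCast_p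
  have hpmem : ((p : ℕ) : unrIntegers p) ∈ IsLocalRing.maximalIdeal (unrIntegers p) :=
    (IsLocalRing.mem_maximalIdeal _).mpr hirr.not_isUnit
  have hpt : ∀ z : ℤ_[p], ‖z‖ < 1 → toUnr p z ∈ IsLocalRing.maximalIdeal (unrIntegers p) := by
    intro z hz
    obtain ⟨y, hy⟩ := (PadicInt.norm_lt_one_iff_dvd z).mp hz
    rw [hy, map_mul, map_natCast]
    exact Ideal.mul_mem_right _ _ hpmem
  refine ⟨F, L, x, hxk, hconv, hF, halg, han, fun k => ?_⟩
  obtain ⟨D, hDι, hpar, ΩKg, Ωpg, Lg, hΩKg, hΩpg, hLg, Ψ, hΨ, hank, ⟨s, hsπ, hs⟩, hctrl⟩ := hmem k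
  have ha : toUnr p (x k) ∈ IsLocalRing.maximalIdeal (unrIntegers p) := hpt _ (hxk k)
  -- the evaluation retraction `φ_k : R₀⟦X⟧⟦T⟧ → R₀⟦T⟧`, `X ↦ x_k` (inner variable), kernel `(X - x_k)`
  let φ : PowerSeries (PowerSeries (unrIntegers p)) →+* PowerSeries (unrIntegers p) := evInner (toUnr p (x k)) ha
  have hφC : ∀ g : PowerSeries (unrIntegers p),
      φ (algebraMap (PowerSeries (unrIntegers p)) (PowerSeries (PowerSeries (unrIntegers p))) g) = g :=
    fun g => evInner_map_C _ ha g
  have hφπ : φ (PowerSeries.C (PowerSeries.X - PowerSeries.C (toUnr p (x k)))) = 0 := evInner_pi _ ha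
  have hφker : ∀ b : PowerSeries (PowerSeries (unrIntegers p)), φ b = 0 →
      PowerSeries.C (PowerSeries.X - PowerSeries.C (toUnr p (x k))) ∣ b :=
    fun b hb => C_dvd_of_evInner_eq_zero _ ha b hb
  -- ONE-SIDED HERBRAND at the member fibre: `char_{R₀⟦T⟧}(𝒩 / (X - x_k)𝒩) ⊆ (F(x_k, T))`
  have hle := hHer (PowerSeries (unrIntegers p)) (PowerSeries (PowerSeries (unrIntegers p)))
    (PowerSeries.C (PowerSeries.X - PowerSeries.C (toUnr p (x k)))) φ hφC hφπ hφker 𝒩 ⟨s, hsπ, hs⟩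
  rw [hchar, Ideal.map_span, Set.image_singleton] at hle
  refine ⟨D, hDι, hpar, ΩKg, Ωpg, Lg, hΩKg, hΩpg, hLg, φ F, Ψ, ?_, hΨ, hank, ?_⟩
  · -- the fibre `Φ_k := F(x_k, T)` as a remainder: `Φ_k ≡ F (mod X - x_k)`
    obtain ⟨U, hU⟩ := hφker (PowerSeries.map (PowerSeries.C (R := unrIntegers p)) (φ F) - F) (by
      rw [map_sub, sub_eq_zero]
      exact hφC (φ F))
    exact ⟨1, U, by rw [mul_one, ← hU]; ring⟩
  · intro b hb _ _
    obtain ⟨j, hj⟩ := hctrl b hb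
    refine ⟨j, hj.trans ?_⟩
    have hle' := Ideal.map_mono (f := PowerSeries.map (R1.unrToCpInt p)) hle
    rwa [Ideal.map_span, Set.image_singleton] at hle'


/-! ## §P The patch theorems: the registered stub from the two new stubs -/

/-- **`stub_telescopeCarrier` FROM THE SPLIT** (conditional on the two sorried stubs above; nothing is proved). -/
theorem stub_telescopeCarrier_of_K2split : TelescopeCarrierStatement :=
  telescopeCarrier_of_witness stub_selmerWitness stub_herbrandTranslate

/-- SPLICE CERTIFICATE: the same term elaborates against the RAW registered text of `stub_telescopeCarrier`
(copied token-for-token from `Lines/telescope.lean` of record, sha256 1d5bbb30…), i.e. exactly what the binder of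
`MemberDivOfThm308.bsdpOnCellC_of_namedFactsV16P` / `TelescopeKernel.kolyvaginDiv_signFree_of_telescope` expects. -/
example :
    ∀ (W : WeierstrassCurve ℚ) [W.IsElliptic] [W.IsGloballyMinimal] (p : ℕ) [Fact p.Prime],
    ∀ (N : ℕ) [NeZero N] (K : Type) [Field K] [NumberField K] (Dt : ModularParametrizationData W N)
      (H : HeegnerDatum N (NumberField.discr K)) (ιK : K →+* ℂ) (P : (W.baseChange K).toAffine.Point),
      CellC W p → W.conductorNorm ℤ = N →
      IsImaginaryQuadratic K → NumberField.discr K < -4 → SatisfiesHeegnerHypothesis N K →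
      (W.quadraticTwist (NumberField.discr K : ℚ)).entireLFunction 1 ≠ 0 →
      WeierstrassCurve.Affine.Point.map ιK.toRatAlgHom P = heegnerPointComplex Dt H →
      ¬ (p : ℤ) ∣ Dt.c → ¬ IsOfFinAddOrder P →
      Odd (NumberField.discr K) →
      ∀ (κ : ZpExtension K p), κ.IsAnticyclotomic →
        ∀ (γ : Field.absoluteGaloisGroup K) [Fact (κ.IsTopGenerator γ)]
          (𝔭 : HeightOneSpectrum (𝓞 K)), ((p : ℕ) : 𝓞 K) ∈ 𝔭.asIdeal →
          𝔭.asIdeal.ramificationIdx (𝓞 ℚ) = 1 → 𝔭.asIdeal.inertiaDeg (𝓞 ℚ) = 1 →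
          ∀ (𝔭bar : HeightOneSpectrum (𝓞 K)), ((p : ℕ) : 𝓞 K) ∈ 𝔭bar.asIdeal → 𝔭bar ≠ 𝔭 →
            ((Ideal.span {(p : ℤ)}).primesOver (𝓞 K)).ncard = 2 →
          ∀ (f : CuspForm (CongruenceSubgroup.Gamma0 N) 2), IsNewformOf W f →
            ∀ (ι' : PadicAlgCl p ≃+* ℂ),
              (∀ (w : InfinitePlace K) (k : 𝓞 K),
                k ∈ 𝔭.asIdeal ↔ ‖ι'.symm (w.embedding (k : K))‖ < 1) →
              ∀ (ΩK : ℂ) (Ωp : ℂ_[p]) (Q : PowerSeries 𝓞_ℂ_[p]), ΩK ≠ 0 → ‖Ωp‖ = 1 →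
                R1.IsBDPLFunctionInt p ι' 𝔭 κ γ f ΩK Ωp Q →
      ∃ (F L : PowerSeries (PowerSeries (unrIntegers p))) (x : ℕ → ℤ_[p]),
        (∀ k, ‖x k‖ < 1) ∧ Filter.Tendsto x Filter.atTop (nhds 0) ∧
        ¬ (PowerSeries.C (PowerSeries.X : PowerSeries (unrIntegers p)) ∣ F) ∧
        (∃ j : ℕ, PowerSeries.C ((p : 𝓞_ℂ_[p]) ^ j) *
            PowerSeries.map (R1.unrToCpInt p) (PowerSeries.map (PowerSeries.constantCoeff (R := unrIntegers p)) F) ∈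
          (XAc.charIdeal (W.baseChange K) p κ 𝔭bar ∅ γ).map (PowerSeries.map (R1.toCpInt p))) ∧
        (∃ e : ℕ, PowerSeries.C ((p : 𝓞_ℂ_[p]) ^ e) * Q ∈
          Ideal.span {PowerSeries.map (R1.unrToCpInt p) (PowerSeries.map (PowerSeries.constantCoeff (R := unrIntegers p)) L)}) ∧
        ∀ k : ℕ, ∃ (D : Skinner2016.HidaCongruentForm W p 1),
          (∀ y : coeffField D.g, ι' (D.ι y) = (y : ℂ)) ∧ 2 * ((p : ℤ) - 1) ∣ D.k - 2 ∧
          ∃ (ΩKg : ℂ) (Ωpg : ℂ_[p]) (Lg : UnrSeries p), ΩKg ≠ 0 ∧ ‖Ωpg‖ = 1 ∧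
            IsBDPLFunctionWt ι' 𝔭 κ γ D.g ΩKg Ωpg Lg ∧
          ∃ (Φ Ψ : UnrSeries p),
            (∃ G U : PowerSeries (PowerSeries (unrIntegers p)),
              PowerSeries.map (PowerSeries.C (R := unrIntegers p)) Φ =
                F * G + PowerSeries.C (PowerSeries.X - PowerSeries.C (toUnr p (x k))) * U) ∧
            (∃ U : PowerSeries (PowerSeries (unrIntegers p)),
              PowerSeries.map (PowerSeries.C (R := unrIntegers p)) Ψ =
                L + PowerSeries.C (PowerSeries.X - PowerSeries.C (toUnr p (x k))) * U) ∧
            (∃ e : ℕ, PowerSeries.C ((p : 𝓞_ℂ_[p]) ^ e) * PowerSeries.map (R1.unrToCpInt p) Ψ ∈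
              Ideal.span {PowerSeries.map (R1.unrToCpInt p) Lg}) ∧
            ∀ (b : padicCoeffIntegers D.ι →+* 𝓞_ℂ_[p]),
              (∀ y, ((b y : 𝓞_ℂ_[p]) : ℂ_[p]) =
                algebraMap (PadicAlgCl p) ℂ_[p] (padicCoeffIntegers.toPadicAlgCl D.ι y)) →
            ∀ [TopologicalSpace (PowerSeries (padicCoeffIntegers D.ι))]
              [ContinuousSMul (PowerSeries (padicCoeffIntegers D.ι))
                (BigRepModule (padicCoeffIntegers D.ι) p (Cofree D.Δ.selfDualRep (padicCoeffField D.ι)))],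
              ∃ j : ℕ, Ideal.span {PowerSeries.C ((p : 𝓞_ℂ_[p]) ^ j)} *
                  (XBig.charIdeal κ (D.Δ.selfDualCofreeRepOver K) 𝔭bar
                    (∅ : Set (HeightOneSpectrum (𝓞 K)))).map (PowerSeries.map b) ≤
                Ideal.span {PowerSeries.map (R1.unrToCpInt p) Φ}
 :=
  telescopeCarrier_of_witness stub_selmerWitness stub_herbrandTranslate

#print axioms telescopeCarrier_of_witness
#print axioms stub_telescopeCarrier_of_K2split

end Summit.BirchSwinnertonDyer.BirchSwinnertonDyer.Cruxes.BSDpOnCellC.Telescope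

end
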